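import Summits.BirchSwinnertonDyer.BirchSwinnertonDyer.Theorems.KatoDescentPotSupersingularReducibleFineSelmerRationalTorsion
import Literature.NumberTheory.NumberFields.CyclotomicFieldsSevenNineClassNumber
import Literature.NumberTheory.NumberFields.CyclotomicFieldElevenClassNumber
import HarnessLib

/-!
# Coates–Sujatha's statement (A) on the cyclotomic-Borel rows at `p = 7` and `p = 11` with NOTHING displayed
# (`h(ℚ(μ_7)) = h(ℚ(μ_11)) = 1` are tree theorems); (A) at `7` for every `E/ℚ` with a rational point of order `7`

Seat `bsd-potss-rkm` g35 (prover; cell `bsd-potss`), item stmt-BirchSwinnertonDyer-19196 `ReducibleKatoMember` = crux M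
of the routes K9 / K8-t′ (`--supports`, helper; closes nothing).  HONEST FRAMING (cell): BSD is not proved by any of this;
nothing is booked; crux M stays cite-level; its class-wide trust base is unchanged.

The prequels (`…ReducibleFineSelmerBorelCyclotomic`, `…ReducibleFineSelmerRationalTorsion`, this seat) prove (A) on a
reducible row whose stable line is fixed pointwise by `Gal(ℚ̄/L)`, `L ⊆ ℚ̄` a `p`-th cyclotomic field, DISPLAYING
`p ∤ #Cl(𝓞 L)` — discharged there at `p = 3, 5` by Mathlib's `three_pid` / `five_pid`.  The tree ALSO proves
`h(K') = 1` for every 7-th and every 11-th cyclotomic extension `K'/ℚ` (cell lane of `Geometry/Kaehler`: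
`Literature.NumberTheory.NumberFields.classNumber_eq_one_of_isCyclotomicExtension_seven` / `…_eleven`, Marcus Ch. 5
Exercise 17 / Thm. 37 via Minkowski's bound and the residue degrees of `2, 3` — Washington Thm. 11.1, Masley–Montgomery),
so the same statements hold at `p = 7, 11` with NOTHING displayed:

* `fineSelmerDual_moduleFinite_of_borelField_le_cyclotomic_seven / _eleven` — `W.borelField C ≤ L` ⟹ (A).
* `fineSelmerDual_moduleFinite_seven/eleven_of_forall_mem_fixingSubgroup_smul_eq` — `C` fixed pointwise by `Gal(ℚ̄/L)`
  (Weil-pairing bridge `borelField_le_of_forall_mem_fixingSubgroup_smul_eq`) ⟹ (A); at `p = 11` this is the shape of the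
  `X_0(11)`-isogeny rows (`121a`, `121c`, …: isogeny characters of `11`-power conductor).
* **`fineSelmerDual_moduleFinite_seven_of_fixed_point`** — (A) at `p = 7` for EVERY elliptic `W/ℚ` with a non-zero
  `Γ_ℚ`-fixed `Q ∈ W[7](ℚ̄)` (= a rational point of order `7`, the `X_1(7)` family) and every cyclotomic `ℤ_7`-extension —
  FACT-FREE, NOTHING displayed.  With the prequel's `p = 3, 5` statements: **for every odd prime `p` and every `E/ℚ`
  with a rational point of order `p` (Mazur: `p ∈ {3, 5, 7}`), Conjecture A at `p` is a kernel theorem.**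

References: [CoatesSujatha2005] Cor. 3.6; [Greenberg2001IwasawaPastPresent] Prop. 2.1, p. 342; [Marcus2018] Ch. 5 Ex. 17;
[Washington1997] Thm. 11.1; [SilvermanAEC2009] Prop. III.8.1.
-/

-- the summit and its single problem are both named `BirchSwinnertonDyer` (registry layout D-0017)
set_option linter.dupNamespace false
set_option autoImplicit false

noncomputable section

open scoped Classical NumberField

namespace Summit.BirchSwinnertonDyer.BirchSwinnertonDyer.Theorems.ReducibleFineSelmerBorelCyclotomicSevenEleven

open NumberField IsDedekindDomain Field WeierstrassCurve IntermediateField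
open Literature.NumberTheory.EllipticCurves Literature.NumberTheory.EllipticCurves.GreenbergSelmer
  Literature.NumberTheory.GaloisRepresentations Literature.NumberTheory.IwasawaTheory
  Literature.NumberTheory.NumberFields
  Literature.NumberTheory.EllipticCurves.IwasawaAlgebra
  Summit.BirchSwinnertonDyer.BirchSwinnertonDyer.Theorems

/-! ## §0 Class number one, in the `Nat.card` spelling of the doors -/

/-- `7 ∤ #Cl(𝓞 L')` for every `7`-th cyclotomic extension `L'/ℚ` (`h = 1`, tree theorem). Stated for an abstract field so
that it applies to either `ℚ`-algebra structure carried by a subfield of `ℚ̄`. [cite: Marcus2018, Ch. 5 Exercise 17] -/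
theorem not_dvd_card_classGroup_of_isCyclotomicExtension_seven (L' : Type) [Field L'] [NumberField L']
    (h : IsCyclotomicExtension {7} ℚ L') : ¬ 7 ∣ Nat.card (ClassGroup (𝓞 L')) := by
  rw [Nat.card_eq_fintype_card]
  change ¬ 7 ∣ NumberField.classNumber L'
  rw [classNumber_eq_one_of_isCyclotomicExtension_seven L' h]
  decide

/-- `11 ∤ #Cl(𝓞 L')` for every `11`-th cyclotomic extension `L'/ℚ` (`h = 1`, tree theorem). [cite: Washington1997, Thm. 11.1] -/
theorem not_dvd_card_classGroup_of_isCyclotomicExtension_eleven (L' : Type) [Field L'] [NumberField L']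
    (h : IsCyclotomicExtension {11} ℚ L') : ¬ 11 ∣ Nat.card (ClassGroup (𝓞 L')) := by
  rw [Nat.card_eq_fintype_card]
  change ¬ 11 ∣ NumberField.classNumber L'
  rw [classNumber_eq_one_of_isCyclotomicExtension_eleven L' h]
  decide

/-! ## §1 `p = 7` -/

/-- **(A) on a cyclotomic-Borel row at `p = 7` — NOTHING displayed** (`h(ℚ(μ_7)) = 1`, tree theorem
`classNumber_eq_one_of_isCyclotomicExtension_seven`). [cite: CoatesSujatha2005, Cor. 3.6]
[cite: Greenberg2001IwasawaPastPresent, Prop. 2.1 p. 339 and p. 342] [cite: Marcus2018, Ch. 5 Exercise 17] -/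
theorem fineSelmerDual_moduleFinite_of_borelField_le_cyclotomic_seven
    (W : WeierstrassCurve ℚ) [W.IsElliptic] [Fact (7 : ℕ).Prime]
    (κ : ZpExtension ℚ 7) (hκ : κ.IsCyclotomic)
    (C : AddSubgroup (W.geomTorsion ((7 : ℕ) : ℤ)))
    (hC : ∀ (σ : absoluteGaloisGroup ℚ) (x : W.geomTorsion ((7 : ℕ) : ℤ)), x ∈ C → σ • x ∈ C)
    (h1 : C ≠ ⊥) (h2 : C ≠ ⊤)
    (L : IntermediateField ℚ (AlgebraicClosure ℚ)) [hL : IsCyclotomicExtension {7} ℚ L]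
    (hB : W.borelField C ≤ L) :
    ∃ (γ : Field.absoluteGaloisGroup ℚ) (D : W.FineSelmerDualData κ γ),
      Module.Finite ℤ_[7] (RestrictScalars ℤ_[7] (IwasawaAlgebra 7) D.X) := by
  haveI : NumberField L := IsCyclotomicExtension.numberField {7} ℚ L
  exact ReducibleFineSelmerBorelCyclotomic.fineSelmerDual_moduleFinite_of_borelField_le_cyclotomic W 7 (by decide)
    κ hκ C hC h1 h2 L hB (not_dvd_card_classGroup_of_isCyclotomicExtension_seven ↥L hL)

/-- **(A) at `p = 7` for a stable line fixed pointwise by `Gal(ℚ̄/L)`, `L ⊆ ℚ̄` a `7`-th cyclotomic field — NOTHING displayed.**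
[cite: CoatesSujatha2005, Cor. 3.6] [cite: SilvermanAEC2009, Prop. III.8.1] [cite: Marcus2018, Ch. 5 Exercise 17] -/
theorem fineSelmerDual_moduleFinite_seven_of_forall_mem_fixingSubgroup_smul_eq
    (W : WeierstrassCurve ℚ) [W.IsElliptic] [Fact (7 : ℕ).Prime]
    (κ : ZpExtension ℚ 7) (hκ : κ.IsCyclotomic)
    (C : AddSubgroup (W.geomTorsion ((7 : ℕ) : ℤ)))
    (hC : ∀ (σ : absoluteGaloisGroup ℚ) (x : W.geomTorsion ((7 : ℕ) : ℤ)), x ∈ C → σ • x ∈ C)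
    (h1 : C ≠ ⊥) (h2 : C ≠ ⊤)
    (L : IntermediateField ℚ (AlgebraicClosure ℚ)) [hL : IsCyclotomicExtension {7} ℚ L]
    (hCL : ∀ σ : absoluteGaloisGroup ℚ, σ ∈ (L.fixingSubgroup : Subgroup (absoluteGaloisGroup ℚ)) →
      ∀ x : W.geomTorsion ((7 : ℕ) : ℤ), x ∈ C → σ • x = x) :
    ∃ (γ : Field.absoluteGaloisGroup ℚ) (D : W.FineSelmerDualData κ γ),
      Module.Finite ℤ_[7] (RestrictScalars ℤ_[7] (IwasawaAlgebra 7) D.X) := by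
  haveI : NumberField L := IsCyclotomicExtension.numberField {7} ℚ L
  exact ReducibleFineSelmerRationalTorsion.fineSelmerDual_moduleFinite_of_forall_mem_fixingSubgroup_smul_eq W 7
    (by decide) κ hκ C hC h1 h2 L hCL (not_dvd_card_classGroup_of_isCyclotomicExtension_seven ↥L hL)

/-- **Coates–Sujatha's (A) at `p = 7` for EVERY elliptic curve over `ℚ` with a rational point of order `7` — FACT-FREE,
NOTHING displayed** (a non-zero `Γ_ℚ`-fixed `Q ∈ W[7](ℚ̄)`; `ℚ(ζ_7) ⊆ ℚ̄` exists, `h(ℚ(ζ_7)) = 1`).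
[cite: CoatesSujatha2005, Cor. 3.6] [cite: Greenberg2001IwasawaPastPresent, p. 342] [cite: Marcus2018, Ch. 5 Exercise 17] -/
theorem fineSelmerDual_moduleFinite_seven_of_fixed_point
    (W : WeierstrassCurve ℚ) [W.IsElliptic] [Fact (7 : ℕ).Prime]
    (Q : W.geomTorsion ((7 : ℕ) : ℤ)) (hQ0 : Q ≠ 0) (hQfix : ∀ σ : absoluteGaloisGroup ℚ, σ • Q = Q)
    (κ : ZpExtension ℚ 7) (hκ : κ.IsCyclotomic) :
    ∃ (γ : Field.absoluteGaloisGroup ℚ) (D : W.FineSelmerDualData κ γ),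
      Module.Finite ℤ_[7] (RestrictScalars ℤ_[7] (IwasawaAlgebra 7) D.X) := by
  obtain ⟨L, hL⟩ := WeierstrassCurve.exists_isCyclotomicExtension_intermediateField (K := ℚ) (p := 7)
  haveI hL' : IsCyclotomicExtension {7} ℚ ↥L := ReducibleFineSelmerRationalTorsion.isCyclotomicExtension_rat_transport _ hL
  haveI : NumberField L := IsCyclotomicExtension.numberField {7} ℚ L
  refine ReducibleFineSelmerRationalTorsion.fineSelmerDual_moduleFinite_of_fixed_point W 7 (by decide) Q hQ0 hQfix κ hκ L ?_
  exact not_dvd_card_classGroup_of_isCyclotomicExtension_seven _ hL'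

/-! ## §2 `p = 11` -/

/-- **(A) on a cyclotomic-Borel row at `p = 11` — NOTHING displayed** (`h(ℚ(μ_11)) = 1`, tree theorem
`classNumber_eq_one_of_isCyclotomicExtension_eleven`). [cite: CoatesSujatha2005, Cor. 3.6]
[cite: Greenberg2001IwasawaPastPresent, Prop. 2.1 p. 339 and p. 342] [cite: Washington1997, Thm. 11.1] -/
theorem fineSelmerDual_moduleFinite_of_borelField_le_cyclotomic_eleven
    (W : WeierstrassCurve ℚ) [W.IsElliptic] [Fact (11 : ℕ).Prime]
    (κ : ZpExtension ℚ 11) (hκ : κ.IsCyclotomic)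
    (C : AddSubgroup (W.geomTorsion ((11 : ℕ) : ℤ)))
    (hC : ∀ (σ : absoluteGaloisGroup ℚ) (x : W.geomTorsion ((11 : ℕ) : ℤ)), x ∈ C → σ • x ∈ C)
    (h1 : C ≠ ⊥) (h2 : C ≠ ⊤)
    (L : IntermediateField ℚ (AlgebraicClosure ℚ)) [hL : IsCyclotomicExtension {11} ℚ L]
    (hB : W.borelField C ≤ L) :
    ∃ (γ : Field.absoluteGaloisGroup ℚ) (D : W.FineSelmerDualData κ γ),
      Module.Finite ℤ_[11] (RestrictScalars ℤ_[11] (IwasawaAlgebra 11) D.X) := by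
  haveI : NumberField L := IsCyclotomicExtension.numberField {11} ℚ L
  exact ReducibleFineSelmerBorelCyclotomic.fineSelmerDual_moduleFinite_of_borelField_le_cyclotomic W 11 (by decide)
    κ hκ C hC h1 h2 L hB (not_dvd_card_classGroup_of_isCyclotomicExtension_eleven ↥L hL)

/-- **(A) at `p = 11` for a stable line fixed pointwise by `Gal(ℚ̄/L)`, `L ⊆ ℚ̄` an `11`-th cyclotomic field — NOTHING
displayed** (the shape of the `X_0(11)`-isogeny rows). [cite: CoatesSujatha2005, Cor. 3.6] [cite: SilvermanAEC2009, Prop. III.8.1]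
[cite: Washington1997, Thm. 11.1] -/
theorem fineSelmerDual_moduleFinite_eleven_of_forall_mem_fixingSubgroup_smul_eq
    (W : WeierstrassCurve ℚ) [W.IsElliptic] [Fact (11 : ℕ).Prime]
    (κ : ZpExtension ℚ 11) (hκ : κ.IsCyclotomic)
    (C : AddSubgroup (W.geomTorsion ((11 : ℕ) : ℤ)))
    (hC : ∀ (σ : absoluteGaloisGroup ℚ) (x : W.geomTorsion ((11 : ℕ) : ℤ)), x ∈ C → σ • x ∈ C)
    (h1 : C ≠ ⊥) (h2 : C ≠ ⊤)
    (L : IntermediateField ℚ (AlgebraicClosure ℚ)) [hL : IsCyclotomicExtension {11} ℚ L]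
    (hCL : ∀ σ : absoluteGaloisGroup ℚ, σ ∈ (L.fixingSubgroup : Subgroup (absoluteGaloisGroup ℚ)) →
      ∀ x : W.geomTorsion ((11 : ℕ) : ℤ), x ∈ C → σ • x = x) :
    ∃ (γ : Field.absoluteGaloisGroup ℚ) (D : W.FineSelmerDualData κ γ),
      Module.Finite ℤ_[11] (RestrictScalars ℤ_[11] (IwasawaAlgebra 11) D.X) := by
  haveI : NumberField L := IsCyclotomicExtension.numberField {11} ℚ L
  exact ReducibleFineSelmerRationalTorsion.fineSelmerDual_moduleFinite_of_forall_mem_fixingSubgroup_smul_eq W 11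
    (by decide) κ hκ C hC h1 h2 L hCL (not_dvd_card_classGroup_of_isCyclotomicExtension_eleven ↥L hL)

end Summit.BirchSwinnertonDyer.BirchSwinnertonDyer.Theorems.ReducibleFineSelmerBorelCyclotomicSevenEleven

end
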